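import Summits.QuantumFields.YangMills.Theorems.BalabanUVNodesN20KeyedRelWeightAtGappedReading
import Summits.QuantumFields.YangMills.Theorems.BalabanUVNodesN21GappedRoadN20Invariance

/-!
# BalabanUVNodes ∕ N20 (NE7b) — JUNCTION: AT dag-n21-d's GAPPED READING THE CANONICAL PERSISTENT-ACTIVITY FRACTION IS ONE NUMBER FOR ALL DIALS `(ρ, n)` AT EVERY STEP NOT CUTTING
# EXACTLY AT THE TOP — below the top by n21-d's letter-free bad sums (p631…, `sum_badClass₁₃_gapWeight{A,B}₁₃_letter_free`), above the window because it is `1` for every dial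
# (g5 `W_crGap₁₃VAt_eq_one_of_overCut`); hence the N20 face at the gapped reading is ONE statement for all dials under every policy avoiding the top cut

Cell `pub-ymgap` (HUMAN RULING D-0062 Track A; width push D-0149, director-ym №197), width seat `pub-ymgap-dag-n20-w2` (gen 5) on node N20 = NE7b; key item K3⁸
`SpineGivenEndpointR13SepCoPHV` = stmt-QuantumFields-27366 (KEY MAP v2); `--kind proof --supports … --as helper`; COUNT-NEUTRAL; LOCATED.  [LF-II] = [Balaban1989LargeFieldII].

WHY.  dag-n21-d g12's `…N21GappedRoadN20Invariance` proves that on the live line the bad-class sums AND the totals of the gapped carriers `gapWeightA∕B₁₃ … ρ n` do not depend on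
the dials whenever the policy cuts strictly below the top (`jcut K < K₀ + K ∨ jcut K = 0`), and concludes `relWeightBound_gapCarriers_iff` (the face for a GIVEN weight sequence `W` is
dial-free).  This seat's p630052 reads the face through the gapped reading's OWN canonical weight `W := wInf …` (`relWeightBound_crGap₁₃VAt_iff`) and proves `W K = 1` above the
window for every dial (`W_crGap₁₃VAt_eq_one_of_overCut`).  Junction: the ADMISSIBLE-WEIGHT SETS `admW … K` are defined by exactly those four sums, so they coincide across dials below
the top, hence so do the canonical weights; above the window both are `1`.  Only the TOP CUT `jcut K = K₀ + K` reads the re-lettered top entry — there the fraction may depend on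
`(ρ, n)` (no claim).
* §1 `admW_carriersGap₁₃_dial_free` (step-local, `jcut K < K₀+K ∨ jcut K = 0`) · ★★ `W_crGap₁₃VAt_dial_free` (same hypothesis) · ★★ `W_crGap₁₃VAt_dial_free_of_ne_top` (`jcut K ≠ K₀ + K`:
  the over-cut case by `= 1`);
* §2 ★★ `relWeightBound_crGap₁₃VAt_iff_of_dials` (policies with `∀ K, jcut K ≠ K₀ + K`: the N20 face at `crGap₁₃VAt … ρ n` ⟺ at `crGap₁₃VAt … ρ′ n′`, each with ITS canonical `W`) ·
  `keyedRelWeight_shape_crGap₁₃V_iff_of_dials` (`N = 2`, per-tuple cut readings avoiding the top, per-tuple dials).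
WHAT IT SAYS (located, count-neutral): on the gapped road the N20 conjunct of stub 2 does not see the N21 dials at all, except through a top cut nobody proposes; whichever `(ρ, n)` the
N21 side selects (n21-w2's `exists_dials_of_summable`), N20's obligation is the same canonical sequence — NE7b's body at the `ε`-lettered pre-𝐑 top terms (n21-d's reading of it),
NAMED OPEN.  Cited BY NAME, not re-typed: n21-d `sum_badClass₁₃_gapWeight{A,B}₁₃_letter_free`, `sum_classSet₁₃_gapWeight{A,B}₁₃_eq_schemeZ`, `crGap₁₃VAt`; dag-n20-d `admW ∕ wInf`;
this seat p630052 `W_crGap₁₃VAt_eq_one_of_overCut`, `relWeightBound_crGap₁₃VAt_iff`.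

HONEST FRAMING.  [folklore] set ∕ infimum bookkeeping BY NAME; NO weight bounded, NO estimate proved; rows `hsel` (live selector) and (H-ζ) displayed; nothing of Bałaban's asserted;
NE7b NOT PRINTED for `d = 4`, NOT proved; the gapped reading is NOT the registered v6 pin; no `Provisos₁₃CoPH` inhabitant claimed (K0⁷ OPEN); N20 ∕ N21 NOT discharged; K3⁸ NOT
closed; counts unmoved (typed 28∕28 · discharged 5∕27); no count claim.  One finite `𝕋⁴_{L^K}` programme at fixed `ε`; the YM mass gap (Clay) is NOT proved by any of this — R4
closes the conditional finite-𝕋⁴ rung `BalabanLadder.UV` only; NOT ℝ⁴, NOT OS.  No `def`, no `instance`, no `notation`, no `sorry`.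
Sources (locators, bookkeeping only): [LF-II] Thm 1 + (0.1) pp.355–356, (1.80) p.384; [King1986] (3.10)–(3.11) p.656.
-/

noncomputable section

open scoped BigOperators

namespace Summit.QuantumFields.YangMills.BalabanUVNodes.N20KeyedRelWeightAtGappedReadingDialFree

open Literature.MathematicalPhysics.QuantumFieldTheory.Balaban1983to89 Literature.MathematicalPhysics.QuantumFieldTheory.Balaban1983to89.Node00
open T4Continuum
open T4WeightBudget (RelWeightBound)
open YMDAG.UVSplit (SpineReading₁₃CoPH classSet₁₃ badClass₁₃)
open Summit.QuantumFields.YangMills.BalabanUVNodes.SpineCanonicalWeights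
open Summit.QuantumFields.YangMills.Theorems.N21ShellSplitOfRecord13CoPH
open Summit.QuantumFields.YangMills.BalabanUVNodes.N20KeyedRelWeightAtGappedReading (W_crGap₁₃VAt_eq_one_of_overCut relWeightBound_crGap₁₃VAt_iff)

variable {F : T4Family} {N : ℕ} [NeZero N] (θ : Stage13HParams F N) (hP : θ.Provisos₁₃CoPH F N) (K₀ : ℕ) (g₀ : ℕ → ℝ) (os : List (ULoop F))
  (E : B12.RunParams → ℝ) (hsel : θ.ppSel = ppSelLiveOfRecord F N θ.ν θ.τ9 E (wOfRecord₉ F N θ.toStage9Params)) (hζm : ZetaMeasurable F N θ.ζ)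

/-! ## §1  The admissible weights and the canonical weight of the gapped carriers are dial-free below the top; `= 1` above it -/

section Step

include hsel hζm

/-- **THE ADMISSIBLE RELATIVE WEIGHTS AT STEP `K` ARE THE SAME FOR ALL DIALS** when the policy cuts strictly below the top (`jcut K < K₀ + K ∨ jcut K = 0`): the four sums defining
`admW` — both runs' bad-class sums (n21-d's letter-free lemmas) and both totals (E1 ∕ E2 = the partition functions) — do not read `(ρ, n)`. [cite: Balaban1989LargeFieldII, (1.80) p.384 (bookkeeping)] -/
theorem admW_carriersGap₁₃_dial_free {jcut : ℕ → ℕ} (ρ : ℕ → ℝ) (n : ℕ → ℕ) (ρ' : ℕ → ℝ) (n' : ℕ → ℕ) {K : ℕ} (hj : jcut K < K₀ + K ∨ jcut K = 0) :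
    admW 1 (classSet₁₃ θ K₀ g₀) (gapWeightA₁₃ θ hP K₀ g₀ os ρ n) (gapWeightB₁₃ θ hP K₀ g₀ os ρ n) (badClass₁₃ θ K₀ g₀ jcut) K =
      admW 1 (classSet₁₃ θ K₀ g₀) (gapWeightA₁₃ θ hP K₀ g₀ os ρ' n') (gapWeightB₁₃ θ hP K₀ g₀ os ρ' n') (badClass₁₃ θ K₀ g₀ jcut) K := by
  ext w
  simp only [admW, Set.mem_setOf_eq]
  refine and_congr_right fun _ => forall₂_congr fun t _ => ?_
  rw [sum_badClass₁₃_gapWeightA₁₃_letter_free θ hP K₀ g₀ os jcut E hsel hζm ρ n ρ' n' K t hj,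
    sum_badClass₁₃_gapWeightB₁₃_letter_free θ hP K₀ g₀ os jcut E hsel hζm ρ n ρ' n' K t hj,
    sum_classSet₁₃_gapWeightA₁₃_eq_schemeZ K₀ θ hP g₀ os E hsel hζm ρ n K t, sum_classSet₁₃_gapWeightA₁₃_eq_schemeZ K₀ θ hP g₀ os E hsel hζm ρ' n' K t,
    sum_classSet₁₃_gapWeightB₁₃_eq_schemeZ K₀ θ hP g₀ os E hsel hζm ρ n K t, sum_classSet₁₃_gapWeightB₁₃_eq_schemeZ K₀ θ hP g₀ os E hsel hζm ρ' n' K t]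

variable (ρ : WidthLetter₁₃CoPH N) (n : DepthLetter₁₃CoPH N) (ρ' : WidthLetter₁₃CoPH N) (n' : DepthLetter₁₃CoPH N)

/-- **★★ THE GAPPED READING's CANONICAL FRACTION AT STEP `K` IS THE SAME FOR ALL DIALS** when `jcut K < K₀ + K ∨ jcut K = 0` (infimum of the same set).
[cite: Balaban1989LargeFieldII, (1.80) p.384; King1986, (3.10)–(3.11) p.656 (bookkeeping)] -/
theorem W_crGap₁₃VAt_dial_free {jcut : ℕ → ℕ} {K : ℕ} (hj : jcut K < K₀ + K ∨ jcut K = 0) :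
    (crGap₁₃VAt N K₀ jcut ρ n F θ hP g₀ os).W K = (crGap₁₃VAt N K₀ jcut ρ' n' F θ hP g₀ os).W K := by
  show sInf _ = sInf _
  rw [admW_carriersGap₁₃_dial_free θ hP K₀ g₀ os E hsel hζm (ρ F θ hP g₀ os) (n F θ hP g₀ os) (ρ' F θ hP g₀ os) (n' F θ hP g₀ os) hj]

/-- **★★ … AND AT EVERY STEP NOT CUTTING EXACTLY AT THE TOP** (`jcut K ≠ K₀ + K`): below the top by the above, above the window because the fraction is `1` for every dial
(p630052 `W_crGap₁₃VAt_eq_one_of_overCut`).  The top cut `jcut K = K₀ + K` reads the re-lettered top entry — no claim there. [cite: Balaban1989LargeFieldII, (1.80) p.384; King1986, (3.10)–(3.11) p.656 (bookkeeping)] -/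
theorem W_crGap₁₃VAt_dial_free_of_ne_top {jcut : ℕ → ℕ} {K : ℕ} (hK : jcut K ≠ K₀ + K) :
    (crGap₁₃VAt N K₀ jcut ρ n F θ hP g₀ os).W K = (crGap₁₃VAt N K₀ jcut ρ' n' F θ hP g₀ os).W K := by
  rcases lt_or_gt_of_ne hK with hlt | hgt
  · exact W_crGap₁₃VAt_dial_free θ hP K₀ g₀ os E hsel hζm ρ n ρ' n' (Or.inl hlt)
  · rw [W_crGap₁₃VAt_eq_one_of_overCut θ hP K₀ g₀ os ρ n E hsel hζm hgt, W_crGap₁₃VAt_eq_one_of_overCut θ hP K₀ g₀ os ρ' n' E hsel hζm hgt]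

end Step

/-! ## §2  The N20 face at the gapped reading is one statement for all dials (policies avoiding the top cut) -/

section Face

include hsel hζm

/-- **★★ THE N20 FACE AT THE GAPPED READING DOES NOT SEE THE N21 DIALS**: for a policy never cutting exactly at the top (`∀ K, jcut K ≠ K₀ + K`), `RelWeightBound` at
`crGap₁₃VAt N K₀ jcut ρ n …` (its six carriers, its canonical `W`) ⟺ the same at `crGap₁₃VAt N K₀ jcut ρ′ n′ …` — both are `(∀ K, W K < 1) ∧ Summable W` for ONE sequence `W`.  (n21-d's
`relWeightBound_gapCarriers_iff` is the fixed-`W` form below the top; this is the canonical-`W` form, extended over the window's upper end.)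
[cite: Balaban1989LargeFieldII, Thm 1 + (0.1) pp.355–356, (1.80) p.384; King1986, (3.10)–(3.11) p.656 (bookkeeping)] -/
theorem relWeightBound_crGap₁₃VAt_iff_of_dials (ρ : WidthLetter₁₃CoPH N) (n : DepthLetter₁₃CoPH N) (ρ' : WidthLetter₁₃CoPH N) (n' : DepthLetter₁₃CoPH N)
    {jcut : ℕ → ℕ} (hj : ∀ K, jcut K ≠ K₀ + K) :
    RelWeightBound (crGap₁₃VAt N K₀ jcut ρ n F θ hP g₀ os).l₀ (crGap₁₃VAt N K₀ jcut ρ n F θ hP g₀ os).T (crGap₁₃VAt N K₀ jcut ρ n F θ hP g₀ os).A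
        (crGap₁₃VAt N K₀ jcut ρ n F θ hP g₀ os).B (crGap₁₃VAt N K₀ jcut ρ n F θ hP g₀ os).Bad (crGap₁₃VAt N K₀ jcut ρ n F θ hP g₀ os).W ↔
      RelWeightBound (crGap₁₃VAt N K₀ jcut ρ' n' F θ hP g₀ os).l₀ (crGap₁₃VAt N K₀ jcut ρ' n' F θ hP g₀ os).T (crGap₁₃VAt N K₀ jcut ρ' n' F θ hP g₀ os).A
        (crGap₁₃VAt N K₀ jcut ρ' n' F θ hP g₀ os).B (crGap₁₃VAt N K₀ jcut ρ' n' F θ hP g₀ os).Bad (crGap₁₃VAt N K₀ jcut ρ' n' F θ hP g₀ os).W := by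
  have hW : (crGap₁₃VAt N K₀ jcut ρ n F θ hP g₀ os).W = (crGap₁₃VAt N K₀ jcut ρ' n' F θ hP g₀ os).W :=
    funext fun K => W_crGap₁₃VAt_dial_free_of_ne_top θ hP K₀ g₀ os E hsel hζm ρ n ρ' n' (hj K)
  rw [relWeightBound_crGap₁₃VAt_iff, relWeightBound_crGap₁₃VAt_iff, hW]

end Face

/-! ## §3  The K3 binder shape (`N = 2`): per-tuple cut readings avoiding the top, per-tuple dials, on the live line -/

section Shape

/-- **THE `KeyedRelWeight` BODY AT THE PER-TUPLE-CUT GAPPED READING ON LIVE TUPLES IS THE SAME FOR ANY TWO DIAL PAIRS** (`N = 2`; cut readings with `jc … K ≠ K` at every tuple and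
step; rows `hsel` per live tuple and (H-ζ)): a dial-by-dial restatement of §2 under the binders of a gapped pin.  Off the live line nothing is claimed (the letter-free lemmas need
`hsel`). [cite: Balaban1989LargeFieldII, Thm 1 + (0.1) pp.355–356, (1.80) p.384 (bookkeeping)] -/
theorem keyedRelWeight_shape_crGap₁₃V_iff_of_dials
    (jc : (F : T4Family) → (θ : Stage13HParams F 2) → θ.Provisos₁₃CoPH F 2 → (ℕ → ℝ) → List (ULoop F) → ℕ → ℕ)
    (ρ ρ' : WidthLetter₁₃CoPH 2) (n n' : DepthLetter₁₃CoPH 2) (E : (F : T4Family) → Stage13HParams F 2 → B12.RunParams → ℝ)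
    (F : T4Family) (θ : Stage13HParams F 2) (hP : θ.Provisos₁₃CoPH F 2)
    (hsel : θ.ppSel = ppSelLiveOfRecord F 2 θ.ν θ.τ9 (E F θ) (wOfRecord₉ F 2 θ.toStage9Params)) (hζm : ZetaMeasurable F 2 θ.ζ)
    (g₀ : ℕ → ℝ) (os : List (ULoop F)) (hj : ∀ K, jc F θ hP g₀ os K ≠ 0 + K) :
    RelWeightBound (crGap₁₃V 2 (jc F θ hP g₀ os) ρ n F θ hP g₀ os).l₀ (crGap₁₃V 2 (jc F θ hP g₀ os) ρ n F θ hP g₀ os).T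
        (crGap₁₃V 2 (jc F θ hP g₀ os) ρ n F θ hP g₀ os).A (crGap₁₃V 2 (jc F θ hP g₀ os) ρ n F θ hP g₀ os).B
        (crGap₁₃V 2 (jc F θ hP g₀ os) ρ n F θ hP g₀ os).Bad (crGap₁₃V 2 (jc F θ hP g₀ os) ρ n F θ hP g₀ os).W ↔
      RelWeightBound (crGap₁₃V 2 (jc F θ hP g₀ os) ρ' n' F θ hP g₀ os).l₀ (crGap₁₃V 2 (jc F θ hP g₀ os) ρ' n' F θ hP g₀ os).T
        (crGap₁₃V 2 (jc F θ hP g₀ os) ρ' n' F θ hP g₀ os).A (crGap₁₃V 2 (jc F θ hP g₀ os) ρ' n' F θ hP g₀ os).B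
        (crGap₁₃V 2 (jc F θ hP g₀ os) ρ' n' F θ hP g₀ os).Bad (crGap₁₃V 2 (jc F θ hP g₀ os) ρ' n' F θ hP g₀ os).W :=
  relWeightBound_crGap₁₃VAt_iff_of_dials θ hP 0 g₀ os (E F θ) hsel hζm ρ n ρ' n' hj

end Shape

end Summit.QuantumFields.YangMills.BalabanUVNodes.N20KeyedRelWeightAtGappedReadingDialFree

end
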